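import Summits.CriticalPhenomena.CardyFormulaZ2.Theorems.CardyComplexConeEdgePrecompactPassageAgree

/-!
# Localisation of a forward-response failure at the last synchronised corner
(line `qkz-strip-boundary-arm` of crux `CardyComplexCone.EdgePrecompact`, stmt-CriticalPhenomena-11387;
deterministic tool for the uniform forward response stability "UFRS" of
`Theorems/CardyComplexConeEdgePrecompactResponseStabilityUniform.lean`)

Setting of `passageSync` / `passageAgree_of_response`: two completed configurations `β₀, β₁` (a datum and
its lattice translate, read in ONE `ω`), two inner-face predicates `In₀, In₁`, the set `I` of medial
vertices inside a ball, and the orbits `Oᵢ = cornerOrbit βᵢ` of Smirnov's successor map. The FORWARD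
RESPONSE of the pair of corners `(c₀, c₁)` (the two start corners, or a common exit corner of the ball)
is the statement: whenever the `β₀`-orbit of `c₀` first re-enters `I` at step `n` through inner faces
(`Str₀ c₀ n`: targets outside `I` before `n`, faces `1..n` inner for `In₀`), the `β₁`-orbit of `c₁`
re-enters `I` at some step `n'` through inner faces, AT THE SAME CORNER and WITH THE SAME TURNING SUM.
UFRS asks that a failure of some forward response has small probability; this file says WHERE a failure
sits, deterministically and for arbitrary `β₀, β₁, In₀, In₁, I`.

Call the index `m ≤ n` of the `β₀`-stretch SYNCHRONISED (at `β₁`-time `k`) if the `β₁`-orbit of `c₁`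
reaches the corner `O₀ c₀ m` at time `k` through inner faces, avoiding `I`, with the same accumulated
turning (`∑_{i<k} turnOf β₁ = ∑_{i<m} turnOf β₀`). A failure at re-entry time `n` means exactly that `n`
is not synchronised. `responseLocalisation`: then EITHER no index `m ≤ n` is synchronised at all (INITIAL
discrepancy — only possible for the start pair, since a diagonal pair is synchronised at `m = k = 0`:
`responseLocalisation_diag`), OR there is a LAST synchronised index `m < n`, reached at `β₁`-time `k`, at
the corner `e = O₀ c₀ m = O₁ c₁ k`, and then one of
* FACE: the target edge of `e` has the same status in `β₀` and `β₁` (so both orbits step to the same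
  corner `O₀ c₀ (m+1) = O₁ c₁ (k+1)`), whose face is inner for `In₀` but NOT for `In₁`;
* SPLIT: the target edge of `e` has DIFFERENT status in `β₀` and `β₁` (the orbits part at `e`, turning
  by opposite right angles), and every return of the `β₁`-orbit of `e` to the remaining `β₀`-stretch
  `O₀ c₀ (m+1..n)` through inner faces avoiding `I` arrives with a turning mismatch:
  `∑_{i<j} turnOf β₁ (O₁ e i) ≠ ∑_{m ≤ i < j₀} turnOf β₀ (O₀ c₀ i)` whenever `O₁ e j = O₀ c₀ j₀`,
  `m < j₀ ≤ n`, `Str₁ e j` — in particular (first return) the `β₁`-orbit of `e` does not come back to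
  the stretch before entering `I` or leaving the inner faces, or it first comes back with a `2π ℤ`-slip.
The proof is the existence of a largest synchronised index (`Nat.findGreatest`) plus one step of the
two dynamics; no planarity is used.

How the next prover uses it (W10's road map, items 2–4 of the module docstring of
`…ResponseStabilityUniform.lean`). In UFRS, `β₀ = E.bcBondConfig ω`, `β₁ = (shiftData E w).bcBondConfig ω`
agree, together with `In₀ = E.IsInnerFace`, `In₁ = (shiftData E w).IsInnerFace`, away from the
`2η`-collar of `∂D`; so the corner `e` of FACE/SPLIT reads a collar edge or face: the failure is
localised at a collar box `Q ∋ e`, with the `β₀`-stretch arriving at `e` from the ball and leaving to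
the ball (two far-reaching whiskers, along which `β₁` is synchronised). FACE at `e` means the common
orbit crosses the exit edge `e_b` of `shiftData E w` at its `A`-end while that face is inner for `E`;
SPLIT with no timely return is a switch of the collar re-connection (boundary three-arm event at `Q`, or
two-arm at the marked points), SPLIT with a slipped return is an orientation change (the two collar
runs, which cannot cross each other or the whiskers, must wind around `∂D` inside the collar).

References: S. Smirnov, C. R. Acad. Sci. Paris 333 (2001), §2 (the exploration process as a
deterministic turning rule); G. Grimmett, *Percolation* (1999), §11.2.
-/

namespace Summit.CriticalPhenomena.CardyFormulaZ2.Cruxes.EdgePrecompact.QkzStripBoundaryArm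

open MeasureTheory Filter Set Metric
open scoped Topology BigOperators Pointwise
open Literature.Probability.LatticeModels Literature.Probability.Percolation
open Literature.Probability.RandomPlanarGeometry (DobrushinDomain)
open Summit.CriticalPhenomena.CardyFormulaZ2.Theses.CardyComplexCone

noncomputable section

/-! ## One step of the two dynamics -/

/-- Orbits compose: the orbit from time `a` on is the orbit of the corner reached at time `a`. -/
theorem cornerOrbit_add_eq (β : BondConfig (Site 2)) (c : Site 2 × Fin 4) (a i : ℕ) :
    cornerOrbit β c (a + i) = cornerOrbit β (cornerOrbit β c a) i := by
  induction i with
  | zero => rfl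
  | succ i ih =>
    show nextCorner β (cornerOrbit β c (a + i)) = nextCorner β (cornerOrbit β (cornerOrbit β c a) i)
    rw [ih]

/-- The successor reads only the target edge: equal status, equal successor. -/
theorem nextCorner_congr_of_iff {β₀ β₁ : BondConfig (Site 2)} {p : Site 2 × Fin 4}
    (h : cTgt p ∈ β₀ ↔ cTgt p ∈ β₁) : nextCorner β₀ p = nextCorner β₁ p := by
  by_cases h₀ : cTgt p ∈ β₀
  · rw [nextCorner_of_mem h₀, nextCorner_of_mem (h.1 h₀)]
  · rw [nextCorner_of_not_mem h₀, nextCorner_of_not_mem fun h₁ => h₀ (h.2 h₁)]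

/-- The turn reads only the target edge: equal status, equal turn. -/
theorem turnOf_congr_of_iff {β₀ β₁ : BondConfig (Site 2)} {p : Site 2 × Fin 4}
    (h : cTgt p ∈ β₀ ↔ cTgt p ∈ β₁) : turnOf β₀ p = turnOf β₁ p := by
  by_cases h₀ : cTgt p ∈ β₀
  · simp only [turnOf]; rw [if_pos h₀, if_pos (h.1 h₀)]
  · simp only [turnOf]; rw [if_neg h₀, if_neg fun h₁ => h₀ (h.2 h₁)]

/-- Stretch conditions concatenate along composed orbits. -/
theorem stretch_append {β : BondConfig (Site 2)} {In : Site 2 → Prop} {I : Set (Sym2 (Site 2))}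
    {c : Site 2 × Fin 4} {k j : ℕ}
    (hk : ∀ i < k, cTgt (cornerOrbit β c i) ∉ I ∧ In (cFace (cornerOrbit β c (i + 1))))
    (hj : ∀ i < j, cTgt (cornerOrbit β (cornerOrbit β c k) i) ∉ I ∧
      In (cFace (cornerOrbit β (cornerOrbit β c k) (i + 1)))) :
    ∀ i < k + j, cTgt (cornerOrbit β c i) ∉ I ∧ In (cFace (cornerOrbit β c (i + 1))) := by
  intro i hi
  by_cases hik : i < k
  · exact hk i hik
  · obtain ⟨i', rfl⟩ : ∃ i', i = k + i' := ⟨i - k, by omega⟩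
    have := hj i' (by omega)
    rwa [← cornerOrbit_add_eq, ← cornerOrbit_add_eq, ← add_assoc] at this

/-- Turning sums add along composed orbits. -/
theorem sum_turnOf_add (β : BondConfig (Site 2)) (c : Site 2 × Fin 4) (k j : ℕ) :
    ∑ i ∈ Finset.range (k + j), turnOf β (cornerOrbit β c i) =
      ∑ i ∈ Finset.range k, turnOf β (cornerOrbit β c i) +
        ∑ i ∈ Finset.range j, turnOf β (cornerOrbit β (cornerOrbit β c k) i) := by
  rw [Finset.sum_range_add]
  congr 1
  refine Finset.sum_congr rfl fun i _ => ?_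
  rw [cornerOrbit_add_eq]

/-- Turning sums over a `β₀`-stretch split at an intermediate index into a `range` and an `Ico` part. -/
theorem sum_range_eq_add_Ico (f : ℕ → ℝ) {m j₀ : ℕ} (h : m ≤ j₀) :
    ∑ i ∈ Finset.range j₀, f i = ∑ i ∈ Finset.range m, f i + ∑ i ∈ Finset.Ico m j₀, f i := by
  rw [Finset.range_eq_Ico, Finset.range_eq_Ico, Finset.sum_Ico_consecutive _ (Nat.zero_le m) h]


/-! ## Where an orbit leaves the inner faces -/

/-- A step of the successor map that moves the vertex enters the new vertex along an OPEN edge: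
if the vertex changes from time `i` to `i + 1`, the target edge at time `i` is open and contains
the new vertex. -/
theorem cTgt_mem_of_fst_ne {β : BondConfig (Site 2)} {c : Site 2 × Fin 4} {i : ℕ}
    (h : (cornerOrbit β c (i + 1)).1 ≠ (cornerOrbit β c i).1) :
    cTgt (cornerOrbit β c i) ∈ β ∧ (cornerOrbit β c (i + 1)).1 ∈ cTgt (cornerOrbit β c i) := by
  by_cases hm : cTgt (cornerOrbit β c i) ∈ β
  · refine ⟨hm, ?_⟩
    have : cornerOrbit β c (i + 1) = nextCorner β (cornerOrbit β c i) := rfl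
    rw [this, nextCorner_of_mem hm, cTgt]
    exact Sym2.mem_mk_right _ _
  · exfalso
    apply h
    have : cornerOrbit β c (i + 1) = nextCorner β (cornerOrbit β c i) := rfl
    rw [this, nextCorner_of_not_mem hm]

/-- **Exit analysis for an arbitrary orbit** (the general form of `cornerOrbit_exit`, which treats the
orbit of the start corner). For admissible data, if the orbit of a corner `c` in the completed
configuration sits in an inner face at time `n` and NOT at time `n + 1`, then EITHER the vertex of `c`
lies on the discrete arc `B` and the orbit has been turning around it ever since (all edges at an
arc-`B` site are closed), OR the edge reached at time `n` is closed and is an `A`–`B` edge of the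
domain targeted at its `A`-end — i.e. the orbit leaves through the exit edge `e_b` of the exploration
path, at the exploration's exit corner. In UFRS the first alternative is excluded for corners near
the ball (far from `∂D`), which is what the inner-face clauses of the response statements and the
FACE discrepancy of `responseLocalisation` express. -/
theorem orbit_exit_or_stuck {E : DiscreteDobrushin} (hE : E.IsZdAdmissible) (ω : BondConfig (Site 2))
    (c : Site 2 × Fin 4) {n : ℕ}
    (hin : E.IsInnerFace (cFace (cornerOrbit (E.bcBondConfig ω) c n)))
    (hout : ¬ E.IsInnerFace (cFace (cornerOrbit (E.bcBondConfig ω) c (n + 1)))) :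
    (c.1 ∈ E.zdArcB ∧ ∀ i ≤ n + 1, (cornerOrbit (E.bcBondConfig ω) c i).1 = c.1) ∨
    (cTgt (cornerOrbit (E.bcBondConfig ω) c n) ∉ E.bcBondConfig ω ∧
      (cornerOrbit (E.bcBondConfig ω) c n).1 ∈ E.zdArcA ∧
      (cornerOrbit (E.bcBondConfig ω) c n).1 + cornerUnit ((cornerOrbit (E.bcBondConfig ω) c n).2 + 1)
        ∈ E.zdArcB ∧
      E.IsInEdge (cornerOrbit (E.bcBondConfig ω) c n).1 ((cornerOrbit (E.bcBondConfig ω) c n).2 + 1) ∧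
      cTgt (cornerOrbit (E.bcBondConfig ω) c n) ∈ E.zdABEdges) := by
  set x := (cornerOrbit (E.bcBondConfig ω) c n).1 with hx
  set k := (cornerOrbit (E.bcBondConfig ω) c n).2 with hk
  have hpair : cornerOrbit (E.bcBondConfig ω) c n = (x, k) := Prod.ext rfl rfl
  have hclosed : cTgt (cornerOrbit (E.bcBondConfig ω) c n) ∉ E.bcBondConfig ω := fun h =>
    hout (by rw [cornerOrbit_succ, cFace_nextCorner_of_mem h]; exact hin)
  have hIn : E.IsInEdge x (k + 1) := by
    refine ⟨?_, ?_⟩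
    · rw [fin4_add_one_add_three]
      simpa only [hpair, cFace] using hin
    · have := hout
      rw [cornerOrbit_succ, cFace_nextCorner_of_not_mem hclosed] at this
      simpa only [hpair, cFace] using this
  obtain ⟨h1, h2⟩ := hE.arcs_cover_faceBoundary hIn.isFaceBoundaryEdge
  rcases h1 with hxA | hxB
  · -- the vertex is on the arc `A`: the edge is the `A`–`B` in-edge
    right
    have hyB : x + cornerUnit (k + 1) ∈ E.zdArcB := by
      rcases h2 with hyA | hyB
      · exfalso
        refine hclosed ?_
        rw [hpair, cTgt]
        refine DiscreteDobrushin.mem_bcBondConfig_of_arcA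
          ((SimpleGraph.mem_edgeSet _).2 hIn.isFaceBoundaryEdge.1) fun u hu => ?_
        rcases Sym2.mem_iff.1 hu with rfl | rfl
        · exact hxA
        · exact hyA
      · exact hyB
    refine ⟨hclosed, hxA, hyB, hIn, ?_⟩
    rw [hpair, cTgt]
    exact DiscreteDobrushin.cSrc_mem_zdABEdges hxA hyB (Or.inr hIn)
  · -- the vertex is on the arc `B`: all its edges are closed, the orbit never moved
    left
    have hstay : ∀ d i : ℕ, i + d = n → (cornerOrbit (E.bcBondConfig ω) c i).1 = x := by
      intro d
      induction d with
      | zero => intro i hi; rw [add_zero] at hi; subst hi; rfl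
      | succ d ih =>
        intro i hi
        have hnext : (cornerOrbit (E.bcBondConfig ω) c (i + 1)).1 = x := ih (i + 1) (by omega)
        by_contra hne
        rw [← hnext] at hne
        obtain ⟨hopen, hmem⟩ := cTgt_mem_of_fst_ne (Ne.symm hne)
        rw [hnext] at hmem
        exact DiscreteDobrushin.not_mem_bcBondConfig_of_mem_zdArcB hE hmem hxB hopen
    have hc : c.1 = x := hstay n 0 (zero_add n)
    refine ⟨hc ▸ hxB, fun i hi => ?_⟩
    rw [hc]
    rcases Nat.lt_or_eq_of_le hi with hi | rfl
    · exact hstay (n - i) i (by omega)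
    · show (nextCorner (E.bcBondConfig ω) (cornerOrbit (E.bcBondConfig ω) c n)).1 = x
      rw [nextCorner_of_not_mem hclosed]

/-! ## The localisation theorem -/

/-- **Localisation of a forward-response failure** (registered sub-goal `responseLocalisation` of
stmt-CriticalPhenomena-11387; deterministic tool for UFRS). Data: configurations `β₀, β₁`, inner-face
predicates `In₀, In₁`, the set `I` of medial vertices of the ball, corners `c₀, c₁`. HYPOTHESIS: the
forward response of `(c₀, c₁)` fails. CONCLUSION: there is a re-entry time `n` of the `β₀`-orbit of `c₀`
(targets outside `I` before `n`, faces `1..n` inner for `In₀`, target at `n` in `I`) such that EITHER no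
index `m ≤ n` is synchronised (whenever the `β₁`-orbit of `c₁` reaches `cornerOrbit β₀ c₀ m` through an
`I`-avoiding `In₁`-inner stretch, the turning sums differ — INITIAL discrepancy), OR there is a
synchronised index `m < n` (reached at `β₁`-time `k`, same corner, same turning sum) followed by a FACE
discrepancy (equal target-edge status, common next corner, its face inner for `In₀` and not for `In₁`)
or by a SPLIT discrepancy (different target-edge status, and every `I`-avoiding `In₁`-inner return of
the `β₁`-orbit of that corner to the remaining `β₀`-stretch `(m, n]` has a turning mismatch). -/
theorem responseLocalisation : ∀ (β₀ β₁ : BondConfig (Site 2)) (In₀ In₁ : Site 2 → Prop) (I : Set (Sym2 (Site 2))) (c₀ c₁ : Site 2 × Fin 4), (¬ ∀ n : ℕ, (∀ i < n, cTgt (cornerOrbit β₀ c₀ i) ∉ I ∧ In₀ (cFace (cornerOrbit β₀ c₀ (i + 1)))) → cTgt (cornerOrbit β₀ c₀ n) ∈ I → ∃ n' : ℕ, (∀ i < n', cTgt (cornerOrbit β₁ c₁ i) ∉ I ∧ In₁ (cFace (cornerOrbit β₁ c₁ (i + 1)))) ∧ cornerOrbit β₁ c₁ n' = cornerOrbit β₀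 c₀ n ∧ ∑ i ∈ Finset.range n', turnOf β₁ (cornerOrbit β₁ c₁ i) = ∑ i ∈ Finset.range n, turnOf β₀ (cornerOrbit β₀ c₀ i)) → ∃ n : ℕ, (∀ i < n, cTgt (cornerOrbit β₀ c₀ i) ∉ I ∧ In₀ (cFace (cornerOrbit β₀ c₀ (i + 1)))) ∧ cTgt (cornerOrbit β₀ c₀ n) ∈ I ∧ ((∀ m k : ℕ, m ≤ n → (∀ i < k, cTgt (cornerOrbit β₁ c₁ i) ∉ I ∧ In₁ (cFace (cornerOrbit β₁ c₁ (i + 1)))) → cornerOrbit β₁ c₁ k = cornerOrbit β₀ c₀ m → ∑ i ∈ Finset.range k, turnOf β₁ (cornerOrbit β₁ c₁ i) ≠ ∑ i ∈ Finset.range m, turnOf β₀ (cornerOrbit β₀ c₀ i)) ∨ (∃ m k : ℕ, m < n ∧ (∀ i < k, cTgt (cornerOrbit β₁ c₁ i) ∉ I ∧ In₁ (cFace (cornerOrbit β₁ c₁ (i + 1)))) ∧ cornerOrbit β₁ c₁ k = cornerOrbit β₀ c₀ m ∧ ∑ i ∈ Finset.range k, turnOf β₁ (cornerOrbit β₁ c₁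 i) = ∑ i ∈ Finset.range m, turnOf β₀ (cornerOrbit β₀ c₀ i) ∧ (((cTgt (cornerOrbit β₀ c₀ m) ∈ β₀ ↔ cTgt (cornerOrbit β₀ c₀ m) ∈ β₁) ∧ cornerOrbit β₁ c₁ (k + 1) = cornerOrbit β₀ c₀ (m + 1) ∧ In₀ (cFace (cornerOrbit β₀ c₀ (m + 1))) ∧ ¬ In₁ (cFace (cornerOrbit β₀ c₀ (m + 1)))) ∨ (¬ (cTgt (cornerOrbit β₀ c₀ m) ∈ β₀ ↔ cTgt (cornerOrbit β₀ c₀ m) ∈ β₁) ∧ ∀ j j₀ : ℕ, m < j₀ → j₀ ≤ n → (∀ i < j, cTgt (cornerOrbit β₁ (cornerOrbit β₀ c₀ m) i) ∉ I ∧ In₁ (cFace (cornerOrbit β₁ (cornerOrbit β₀ c₀ m) (i + 1)))) → cornerOrbit β₁ (cornerOrbit β₀ c₀ m) j = cornerOrbit β₀ c₀ j₀ → ∑ i ∈ Finset.range j, turnOf β₁ (cornerOrbit β₁ (cornerOrbit β₀ c₀ m) i) ≠ ∑ i ∈ Finset.Ico m j₀, turnOf β₀ (cornerOrbit β₀ c₀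 i))))) := by
  intro β₀ β₁ In₀ In₁ I c₀ c₁ hfail
  classical
  push Not at hfail
  obtain ⟨n, hStr, hIn, hno⟩ := hfail
  refine ⟨n, hStr, hIn, ?_⟩
  -- synchronised indices
  set Sync : ℕ → Prop := fun m => ∃ k : ℕ,
    (∀ i < k, cTgt (cornerOrbit β₁ c₁ i) ∉ I ∧ In₁ (cFace (cornerOrbit β₁ c₁ (i + 1)))) ∧
      cornerOrbit β₁ c₁ k = cornerOrbit β₀ c₀ m ∧
      ∑ i ∈ Finset.range k, turnOf β₁ (cornerOrbit β₁ c₁ i) =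
        ∑ i ∈ Finset.range m, turnOf β₀ (cornerOrbit β₀ c₀ i) with hSync
  by_cases hex : ∃ m, m ≤ n ∧ Sync m
  · right
    obtain ⟨m₁, hm₁n, hm₁⟩ := hex
    have hm : Sync (Nat.findGreatest Sync n) := Nat.findGreatest_spec hm₁n hm₁
    have hmn : Nat.findGreatest Sync n ≤ n := Nat.findGreatest_le n
    have hmax : ∀ m', Nat.findGreatest Sync n < m' → m' ≤ n → ¬ Sync m' :=
      fun m' h₁ h₂ => Nat.findGreatest_is_greatest h₁ h₂
    generalize Nat.findGreatest Sync n = m at hm hmn hmax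
    obtain ⟨k, hStr₁, hek, hsum⟩ := hm
    have hmlt : m < n := by
      refine lt_of_le_of_ne hmn fun hmn' => ?_
      subst hmn'
      exact hno k hStr₁ hek hsum
    refine ⟨m, k, hmlt, hStr₁, hek, hsum, ?_⟩
    by_cases hag : (cTgt (cornerOrbit β₀ c₀ m) ∈ β₀ ↔ cTgt (cornerOrbit β₀ c₀ m) ∈ β₁)
    · -- FACE: both orbits take the same step; the new face must fail `In₁`, by maximality
      left
      have hstep : cornerOrbit β₁ c₁ (k + 1) = cornerOrbit β₀ c₀ (m + 1) := by
        show nextCorner β₁ (cornerOrbit β₁ c₁ k) = nextCorner β₀ (cornerOrbit β₀ c₀ m)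
        rw [hek]
        exact (nextCorner_congr_of_iff hag).symm
      have hIn₀ : In₀ (cFace (cornerOrbit β₀ c₀ (m + 1))) := (hStr m hmlt).2
      refine ⟨hag, hstep, hIn₀, fun hIn₁ => hmax (m + 1) (Nat.lt_succ_self m) hmlt ⟨k + 1, ?_, hstep, ?_⟩⟩
      · intro i hi
        rcases Nat.lt_succ_iff_lt_or_eq.1 hi with hi | rfl
        · exact hStr₁ i hi
        · refine ⟨?_, ?_⟩
          · rw [hek]; exact (hStr m hmlt).1
          · rw [hstep]; exact hIn₁
      · rw [Finset.sum_range_succ, Finset.sum_range_succ, hsum, hek, ← turnOf_congr_of_iff hag]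
    · -- SPLIT: every synchronisable return of the `β₁`-orbit of `e` would synchronise a later index
      right
      refine ⟨hag, fun j j₀ hj₀ hj₀n hStrj hhit heq => hmax j₀ hj₀ hj₀n ⟨k + j, ?_, ?_, ?_⟩⟩
      · have hStrj' : ∀ i < j, cTgt (cornerOrbit β₁ (cornerOrbit β₁ c₁ k) i) ∉ I ∧
            In₁ (cFace (cornerOrbit β₁ (cornerOrbit β₁ c₁ k) (i + 1))) := by
          rw [hek]; exact hStrj
        exact stretch_append hStr₁ hStrj'
      · rw [cornerOrbit_add_eq, hek, hhit]
      · rw [sum_turnOf_add, hek, hsum, heq,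
          sum_range_eq_add_Ico (fun i => turnOf β₀ (cornerOrbit β₀ c₀ i)) hj₀.le]
  · -- INITIAL: no synchronised index at all
    left
    intro m k hmn hStr₁ hek heq
    exact hex ⟨m, hmn, k, hStr₁, hek, heq⟩

/-- **Diagonal form.** For a common corner `c₀ = c₁ = c` (an exit corner of the ball) the index `0` is
synchronised, so a forward-response failure is always localised at a last synchronised corner followed
by a FACE or a SPLIT discrepancy. -/
theorem responseLocalisation_diag : ∀ (β₀ β₁ : BondConfig (Site 2)) (In₀ In₁ : Site 2 → Prop) (I : Set (Sym2 (Site 2))) (c : Site 2 × Fin 4), (¬ ∀ n : ℕ, (∀ i < n, cTgt (cornerOrbit β₀ c i) ∉ I ∧ In₀ (cFace (cornerOrbit β₀ c (i + 1)))) → cTgt (cornerOrbit β₀ c n) ∈ I → ∃ n' : ℕ, (∀ i < n', cTgt (cornerOrbit β₁ c i) ∉ I ∧ In₁ (cFace (cornerOrbit β₁ c (i + 1)))) ∧ cornerOrbit β₁ c n' = cornerOrbit β₀ c n ∧ ∑ i ∈ Finset.range n', turnOf β₁ (cornerOrbit β₁ c i) = ∑ i ∈ Finset.range n, turnOf β₀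 (cornerOrbit β₀ c i)) → ∃ n : ℕ, (∀ i < n, cTgt (cornerOrbit β₀ c i) ∉ I ∧ In₀ (cFace (cornerOrbit β₀ c (i + 1)))) ∧ cTgt (cornerOrbit β₀ c n) ∈ I ∧ (∃ m k : ℕ, m < n ∧ (∀ i < k, cTgt (cornerOrbit β₁ c i) ∉ I ∧ In₁ (cFace (cornerOrbit β₁ c (i + 1)))) ∧ cornerOrbit β₁ c k = cornerOrbit β₀ c m ∧ ∑ i ∈ Finset.range k, turnOf β₁ (cornerOrbit β₁ c i) = ∑ i ∈ Finset.range m, turnOf β₀ (cornerOrbit β₀ c i) ∧ (((cTgt (cornerOrbit β₀ c m) ∈ β₀ ↔ cTgt (cornerOrbit β₀ c m) ∈ β₁) ∧ cornerOrbit β₁ c (k + 1) = cornerOrbit β₀ c (m + 1) ∧ In₀ (cFace (cornerOrbit β₀ c (m + 1))) ∧ ¬ In₁ (cFace (cornerOrbit β₀ c (m + 1)))) ∨ (¬ (cTgt (cornerOrbit β₀ c m) ∈ β₀ ↔ cTgt (cornerOrbit β₀ c m) ∈ β₁) ∧ ∀ j j₀ : ℕ, m < j₀ → j₀ ≤ n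 → (∀ i < j, cTgt (cornerOrbit β₁ (cornerOrbit β₀ c m) i) ∉ I ∧ In₁ (cFace (cornerOrbit β₁ (cornerOrbit β₀ c m) (i + 1)))) → cornerOrbit β₁ (cornerOrbit β₀ c m) j = cornerOrbit β₀ c j₀ → ∑ i ∈ Finset.range j, turnOf β₁ (cornerOrbit β₁ (cornerOrbit β₀ c m) i) ≠ ∑ i ∈ Finset.Ico m j₀, turnOf β₀ (cornerOrbit β₀ c i)))) := by
  intro β₀ β₁ In₀ In₁ I c hfail
  obtain ⟨n, hStr, hIn, h⟩ := responseLocalisation β₀ β₁ In₀ In₁ I c c hfail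
  refine ⟨n, hStr, hIn, h.resolve_left fun hinit => ?_⟩
  exact hinit 0 0 (Nat.zero_le n) (fun i hi => absurd hi (Nat.not_lt_zero i)) rfl (by simp)

end

end Summit.CriticalPhenomena.CardyFormulaZ2.Cruxes.EdgePrecompact.QkzStripBoundaryArm
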